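import Summits.KontsevichZagierPeriods.KontsevichZagierPeriods.Theorems.ComplexOrientationsOrientationKernelRouteExactness
import Summits.KontsevichZagierPeriods.KontsevichZagierPeriods.Theorems.SymplecticScissorsPlanarTransport
import Summits.KontsevichZagierPeriods.KontsevichZagierPeriods.Theorems.ComplexOrientationsOvalSectorDividingLattice

/-!
# Crux `OvalSector` (stmt-KontsevichZagierPeriods-11369) — logical position (crux-strategist r1, 2026-08-17)

Pure composition of LANDED theorems; no new mathematics. Records, kernel-checked:

* `ovalSector_of_kontsevichZagierPeriods` — **S → C**: the crux is a consequence of the summit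
  (`kontsevichZagierPeriods_iff_orientationKernel_and_ovalSector`, Theorems/…RouteExactness).
* `ovalSector_of_planarAreas'` — **PlanarAreas (stmt-4990) → C**: the crux is dominated by the shared
  1-period-layer item (`ovalSector_of_planarAreas`, ibid.; the two `PlanarAreas` decls of routes
  AbelContraction / SymplecticScissors have the same body).
* `ovalSector_of_huberWustholzCurvePeriods` — **HW → C**: the crux is KNOWN MODULO THE PUBLISHED THEOREM
  Huber–Wüstholz 2022 Thm 13.3 (2) (cite-only named fact `HuberWustholzCurvePeriods`, audited faithful on
  stmt-14055), through `planarAreas_of_huberWustholzCurvePeriods` (Theorems/SymplecticScissorsPlanarTransport: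
  real-clothes transfer + proved planar compiler + proved planar semialgebraic Zylev + proved null-set
  bookkeeping) and `ovalSector_of_planarAreas`.
* `typeOneIdentities_of_huberWustholzCurvePeriods'` — the same for the route's engine `TypeOneIdentities`
  (stmt-11368), via `typeOneIdentities_of_ovalSector`.

So `OvalSector` is STRICTLY BELOW the summit in the only sense available: `S → C` is a theorem, `C` itself is
a theorem modulo HW, and `C → S` would make the period conjecture a consequence of Huber–Wüstholz (no such
theorem; cheap probes fail, files `OvalSector_probe_CS*.lean`).
-/

open Literature.NumberTheory.Transcendental
open Summit.KontsevichZagierPeriods.KontsevichZagierPeriods.Theses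

namespace Summit.KontsevichZagierPeriods.ComplexOrientations.OvalSector.Strategist

/-- **S → C.** [Kontsevich–Zagier 2001, §1.2] -/
theorem ovalSector_of_kontsevichZagierPeriods (h : KontsevichZagierPeriods) :
    ComplexOrientations.OvalSector :=
  (Summit.KontsevichZagierPeriods.ComplexOrientations.OrientationKernel.kontsevichZagierPeriods_iff_orientationKernel_and_ovalSector.1
      h).2

/-- **PlanarAreas → C** over the SymplecticScissors copy of the shared decl (same body as the
AbelContraction copy consumed by `ovalSector_of_planarAreas`). [Kontsevich–Zagier 2001, §1.2] -/
theorem ovalSector_of_planarAreas' (h : SymplecticScissors.PlanarAreas) : ComplexOrientations.OvalSector :=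
  Summit.KontsevichZagierPeriods.ComplexOrientations.OrientationKernel.ovalSector_of_planarAreas
    (fun r r' h1 h2 hv => h r r' h1 h2 hv)

/-- **HW → C**: the crux modulo Huber–Wüstholz 2022, Thm 13.3 (2), and nothing else.
[Huber–Wüstholz 2022, Thm 13.3 (2); Kontsevich–Zagier 2001, §1.2] -/
theorem ovalSector_of_huberWustholzCurvePeriods (hHW : HuberWustholzCurvePeriods) :
    ComplexOrientations.OvalSector :=
  ovalSector_of_planarAreas'
    (Summit.KontsevichZagierPeriods.SymplecticScissors.PlanarTransport.planarAreas_of_huberWustholzCurvePeriods hHW)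

/-- **HW → TypeOneIdentities** (the route's engine, stmt-11368), through `OvalSector`.
[Huber–Wüstholz 2022, Thm 13.3 (2)] -/
theorem typeOneIdentities_of_huberWustholzCurvePeriods' (hHW : HuberWustholzCurvePeriods) :
    ComplexOrientations.TypeOneIdentities :=
  Summit.KontsevichZagierPeriods.ComplexOrientations.OrientationKernel.typeOneIdentities_of_ovalSector
    (ovalSector_of_huberWustholzCurvePeriods hHW)

#print axioms ovalSector_of_kontsevichZagierPeriods
#print axioms ovalSector_of_planarAreas'
#print axioms ovalSector_of_huberWustholzCurvePeriods
#print axioms typeOneIdentities_of_huberWustholzCurvePeriods'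

end Summit.KontsevichZagierPeriods.ComplexOrientations.OvalSector.Strategist
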